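import Literature.AlgebraicGeometry.Frobenioids.ArithmeticFrobenioidPerfectionDivSlim
import Literature.AlgebraicGeometry.Frobenioids.RealificationDataCanonical
import HarnessLib

/-!
# Frobenioids I, Thm. 6.4 (i): Div-slim relative to `Φ` ⇒ Div-slim relative to `Φ^rlf` (THE realification)

Mochizuki, *The geometry of Frobenioids I*, Kyushu J. Math. **62** (2008), proof of Thm. 6.4 (i), kurims
p. 115 l. 20–21: "`D` is Div-slim [relative to `Φ`], hence also relative to `Φ^pf`, `Φ^rlf`"; Def. 4.5 (iv)
p. 86 (Div-slim) [cite: MochizukiFrdI2008, Thm. 6.4 (i) p.115] [cite: MochizukiFrdI2008, Def. 4.5 (iv) p.86]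
— the `Φ^rlf` half of sub-DAG row FrdI:Thm6.4(i)/T64i-L07 (the `Φ^pf` half and the generic transport
`PreFrobenioidData.IsDivSlim.of_injective_hom` are abc-iut-L6-t10's `ArithmeticFrobenioidPerfectionDivSlim.lean`,
whose header says: "the `Φ^rlf` half waits for THE realification … abc-iut-L1-d2's `RealificationData.canonical`").

PROOF-ONLY: for `Φ` with perf-factorial values the natural map `Φ(X) → Φ(X)^pf → Φ(X)^rlf` into THE
realification `Φ^rlf = rlfFunctor Φ hΦ` (`RealificationDataCanonical.lean` / `RealificationFunctor.lean`) is
INJECTIVE (`M → M^pf` injective for divisorial `M`, §0 p. 11; the factorization homomorphism `M^pf → M^rlf`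
injective, Def. 2.4 (i)(c)) and compatible with pull-backs (naturality of `toRlfNatTrans`), so L6-t10's
transport applies: Div-slim w.r.t. `Φ` ⟹ Div-slim w.r.t. `Φ^rlf` for the data `PreFrobenioidData.ofFunctor`
of any functor `C' → F_{Φ^rlf}` over the same `D` (e.g. THE realification `C^rlf`, `PreFrobenioid.rlf`).
Seat abc-iut-L1-d2 (cell abc-iut); sub-DAG row FrdI:Thm6.4(i)/T64i-L07 (rlf half, monoid-functor level).
-/

namespace Literature.AlgebraicGeometry.Frobenioids

open CategoryTheory Opposite Function Literature.AnabelianGeometry.EtaleTheta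

universe w v v' v'' u u' u''

variable {D : Type u} [Category.{v} D] (Φ : Dᵒᵖ ⥤ CommMonCat.{w})
  {C : Type u'} [Category.{v'} C] (F : C ⥤ ElemFrobenioid Φ)
  {C' : Type u''} [Category.{v''} C']

/-- **The natural map `Φ(X) → Φ(X)^rlf` of THE realification is injective** (for perf-factorial `Φ(X)`:
`M → M^pf` is injective since `M` is divisorial, and the factorization homomorphism `M^pf → M^rlf` is
injective by Def. 2.4 (i)(c)). [cite: MochizukiFrdI2008, Def. 2.4(i) p.47] -/
theorem toRlfNatTrans_app_injective (hΦ : ∀ X : Dᵒᵖ, IsPerfFactorial (Φ.obj X)) (X : Dᵒᵖ) :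
    Injective ((toRlfNatTrans Φ hΦ).app X).hom := by
  intro a b hab
  have h1 : (hΦ X).toRealification (Perfection.of _ a) = (hΦ X).toRealification (Perfection.of _ b) := hab
  exact of_injective_of_isSharp_isIntegral_isSaturated (hΦ X).isDivisorial.isSharp
    (hΦ X).isDivisorial.isPreDivisorial.isIntegral (hΦ X).isDivisorial.isPreDivisorial.isSaturated
    ((hΦ X).factorMap_injective (congrArg Subtype.val h1))

/-- **Div-slim relative to `Φ` ⇒ Div-slim relative to `Φ^rlf`** (THE realification `rlfFunctor Φ hΦ` of a
monoid `Φ` on `D` with perf-factorial values), for the data of any `C' → F_{Φ^rlf}` over the same `D` — in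
particular for THE realification `C^rlf` (Thm. 6.4 (i), p. 115 l. 20–21, `Φ^rlf` half of row T64i/L07).
[cite: MochizukiFrdI2008, Thm. 6.4 (i) p.115] -/
theorem isDivSlim_ofFunctor_rlf (hΦ : ∀ X : Dᵒᵖ, IsPerfFactorial (Φ.obj X))
    (F' : C' ⥤ ElemFrobenioid (rlfFunctor Φ hΦ))
    (h : (PreFrobenioidData.ofFunctor Φ F).IsDivSlim) : (PreFrobenioidData.ofFunctor _ F').IsDivSlim :=
  PreFrobenioidData.IsDivSlim.of_injective_hom (PreFrobenioidData.ofFunctor Φ F) (PreFrobenioidData.ofFunctor _ F')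
    (fun X => ((toRlfNatTrans Φ hΦ).app (op X)).hom) (fun X => toRlfNatTrans_app_injective Φ hΦ (op X))
    (fun σ x => rlfMap_toRealification_of Φ hΦ σ.op x) h

/-- The same with THE realification data's `toRlf` (`(RealificationData.canonical Φ hΦ).toRlf = toRlfNatTrans`):
Div-slim w.r.t. `Φ` ⇒ Div-slim w.r.t. `(canonical Φ hΦ).rlf` for the data of THE realification
`(canonical Φ hΦ).RlfModelOf Ψ` of a model Frobenioid (its structure functor `ModelFrobenioid.toElem`).
[cite: MochizukiFrdI2008, Thm. 6.4 (i) p.115] -/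
theorem isDivSlim_rlfModelOf (hΦ : ∀ X : Dᵒᵖ, IsPerfFactorial (Φ.obj X)) (Ψ : GpSubfunctor Φ)
    (h : (PreFrobenioidData.ofFunctor Φ F).IsDivSlim) :
    (PreFrobenioidData.ofFunctor _
      (ModelFrobenioid.toElem (RealificationData.canonical Φ hΦ).rlf
        ((RealificationData.canonical Φ hΦ).realSpan Ψ).toMonoid
        ((RealificationData.canonical Φ hΦ).realSpan Ψ).incl)).IsDivSlim :=
  isDivSlim_ofFunctor_rlf Φ F hΦ _ h

end Literature.AlgebraicGeometry.Frobenioids
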